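import Literature.RepresentationTheory.MoeglinVignerasWaldspurger1987.RankOneThetaLiftLineTypes
import Literature.RepresentationTheory.MoeglinVignerasWaldspurger1987.RankOneOscillatorMultiplicityOne
import Literature.RepresentationTheory.TwistedCoinvariantsCompactExistsType
import HarnessLib

/-!
# The two-block TYPE CRITERION for the rank-one theta lift `Θ_s(χ)` through a line: `Θ_s(χ) ≠ 0` iff SOME `U(J₁)`-type of
# `ω_{s₁}` pairs with a non-zero coinvariant of the second block (non-split place, `n₁ = 1`)

[MoeglinVignerasWaldspurger1987] C. Mœglin, M.-F. Vignéras, J.-L. Waldspurger, LNM 1291 (1987), Chap. 2 II.1 Rem. (6) (restriction of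
the oscillator representation of `Sp(𝕎₁ ⊕ 𝕎₂)` to `Sp(𝕎₁) × Sp(𝕎₂)` is `ω₁ ⊗ ω₂`), read for the unitary see-saw `U(J₁) × U(J₂) ⊂ U(J₁ ⊕ J₂)` of
[Kudla1984, §1].  Topic `RepresentationTheory/MoeglinVignerasWaldspurger1987`; namespace
`Literature.RepresentationTheory.MoeglinVignerasWaldspurger1987` (that of ★ `RankOneThetaLiftLineTypes`).  THEOREMS ONLY (no definition, no named fact,
no `sorry`, no instance, no global notation).  Cell hodgecm-mathlib, fan B rung B-IV; `--supports stmt-HodgeConjecture-24832`.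

SETTING (that of ★ `RankOneThetaLiftLineTypes` with `n₁ = 1`): `E/F` quadratic, `δ`, a finite place `v` with `E ⊗_F F_v` a FIELD, Gram matrices
`T₁` (`1 × 1`) and `T₂` (`n₂ × n₂`) over `F`, `J = (T₁ ⊕ T₂) ⊗ 1`, a section `s` of the metaplectic cover over `ι_v` on `U(J)(F_v)` with `ω_s` smooth,
the centre line `Z = U(J′)(F_v)` with its embeddings `cZ`, `c₁`, `c₂`, the block oscillator representations `ω_{s₁}` (of the compact torus
`U(J₁)(F_v) = E_v¹`) and `ω_{s₂}`, and for a character `χ` of `Z` the theta lift `Θ_s(χ) = Coinv_χ(ω_s ∘ cZ)`.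

* `isSmooth_rep_comp_inlLoc` — the coinvariant representation `Θ_s(χ)` restricted to the first block `U(J₁)(F_v)` is SMOOTH (quotient of the
  smooth `ω_s ∘ (· ⊕ 1)`).
* **`nontrivial_theta_iff_exists_lineType`** — `Θ_s(χ) ≠ 0 ⟺ ∃ ξ` (character of `U(J₁)(F_v)` with OPEN kernel, unitary, continuous) with
  `Coinv_ξ(ω_{s₁}) ≠ 0` AND `Coinv_{χ·(ξ∘c₁)⁻¹}(ω_{s₂} ∘ c₂) ≠ 0`.  (⇒): `Θ_s(χ)|_{U(J₁)}` is a non-zero smooth representation of a compact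
  commutative group, so it HAS a type `ξ` (★ `TwistedCoinv.exists_character_nontrivial_coinv_of_isSmooth`), and ★ `coinvLineEquiv`
  `Coinv_ξ(Θ_s(χ)|U(J₁)) ≃ Coinv_ξ(ω_{s₁}) ⊗ Coinv_{χ·(ξ∘c₁)⁻¹}(ω_{s₂} ∘ c₂)` splits the non-vanishing (★ `nontrivial_tensor_iff`).  (⇐): the same
  equivalence backwards, then a non-zero coinvariant space has a non-zero source (★ `TwistedCoinv.nontrivial_of_nontrivial_coinv`).
* `nontrivial_theta_of_lineTypes` — the (⇐) half alone, for ANY `ξ` (no topology on `ξ` needed).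

Compared with ★ `nontrivial_coinv_line_iff` (same file family: `2 ≤ n₂`, `(E_v^{n₂}, J₂)` ISOTROPIC, where the second factor is never zero by
[MVW, IV.2]), this criterion has NO isotropy ∕ rank hypothesis on the second block: it is the see-saw reading used when the second block is itself
a LINE (`n₂ = 1`, the ANISOTROPIC PLANE `⟨t₁⟩ ⊕ ⟨t₂⟩` of [Liu2021, Lem. D.1 (1)]: `Θ_s(χ) ≠ 0` iff the type sets of the two `(U(1), U(1))`
oscillator representations meet along `ξ ↦ χ·(ξ∘c₁)⁻¹`).  HC_CM is proved only modulo the printed citations — the 2 remaining named inputs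
(hLiu418 = stmt-HodgeConjecture-24832, h413 = 24833) — until rung 0 closes; count-neutral.

## References
* [MoeglinVignerasWaldspurger1987] LNM 1291 (1987), Chap. 2 II.1 Rem. (6); Chap. 3 IV.
* [Kudla1984] S. Kudla, *Seesaw dual reductive pairs*, Progr. Math. 46 (1984), §1.
* [BernsteinZelevinsky1976] I. N. Bernstein, A. V. Zelevinsky, Russian Math. Surveys 31 (1976), §2.1–2.3.
* [Liu2021] Y. Liu, Camb. J. Math. 9 (2021), App. D Lem. D.1 (1) (the anisotropic plane).
-/

set_option autoImplicit false

noncomputable section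

open NumberField IsDedekindDomain
open scoped TensorProduct Matrix
open Literature.RepresentationTheory.HeisenbergGroup (MpPsi)
open Literature.RepresentationTheory.TwistedCoinv
open Literature.NumberTheory.GelbartRogawski1991.UnitaryDualPair.LocalSplitting
open Literature.NumberTheory.GelbartRogawski1991.UnitaryDualPair.LocalSplitting.BlockSum
open Literature.NumberTheory.Automorphic
open Literature.NumberTheory.Automorphic.Liu2021

namespace Literature.RepresentationTheory.MoeglinVignerasWaldspurger1987

variable (F : Type) [Field F] [NumberField F] (E : Type) [Field E] [NumberField E] [Algebra F E]
  [Algebra.IsQuadraticExtension F E] (c : E ≃ₐ[F] E) {δ : E} (hcδ : c δ = -δ) (hδ : δ ≠ 0) {d : F}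
  (hd : δ * δ = algebraMap F E d) (v : HeightOneSpectrum (𝓞 F)) (n₂ : ℕ)
  {T₁ : Matrix (Fin 1) (Fin 1) F} {T₂ : Matrix (Fin n₂) (Fin n₂) F} (hT₁ : T₁.IsSymm) (hT₂ : T₂.IsSymm)
  (hT₁d : IsUnit T₁.det) (hT₂d : IsUnit T₂.det)
  {J₁ : Matrix (Fin 1) (Fin 1) E} (hJ₁ : J₁ = T₁.map (algebraMap F E))
  {J₂ : Matrix (Fin n₂) (Fin n₂) E} (hJ₂ : J₂ = T₂.map (algebraMap F E))
  {J : Matrix (Fin (1 + n₂)) (Fin (1 + n₂)) E} (hJ : J = (UnitaryGroup.finSum 1 n₂ T₁ T₂).map (algebraMap F E))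
  (s : UnitaryGroup.localPi E c (1 + n₂) J v →* LocalMp F (1 + n₂) (UnitaryGroup.finSum 1 n₂ T₁ T₂) v)
  (hs : ∀ g, MpPsi.proj _ (s g) =
    iota F E c (1 + n₂) hcδ hδ hd (UnitaryGroup.finSum 1 n₂ T₁ T₂) (UnitaryGroup.isSymm_finSum hT₁ hT₂) hJ v g)
  {J' : Matrix (Fin 1) (Fin 1) E} (hJ' : J' 0 0 ≠ 0)

-- block-currency terms: about 2× the default budget (as in ★ `RankOneThetaLiftLineTypes`)
set_option maxHeartbeats 400000 in
omit [Algebra.IsQuadraticExtension F E] in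
/-- **`Θ_s(χ)|_{U(J₁)}` is smooth**: the coinvariant representation of `U(J)(F_v)` on `Coinv_χ(ω_s ∘ cZ)`, restricted to the first block
along `u ↦ u ⊕ 1`, has open stabilisers when `ω_s` does (the stabiliser of the class of `f` contains the preimage under the continuous `inlLoc`
of the stabiliser of `f`). [cite: BernsteinZelevinsky1976, §2.1] [cite: Kudla1984, §1] -/
theorem isSmooth_rep_comp_inlLoc
    (hsm : Representation.IsSmooth ((MpPsi.toRep (localSchrodinger F (1 + n₂) (UnitaryGroup.finSum 1 n₂ T₁ T₂) v)).comp s))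
    (χ : (UnitaryGroup.localPi E c 1 J' v) →* ℂˣ) :
    Representation.IsSmooth ((rep (ρW := (((MpPsi.toRep (localSchrodinger F (1 + n₂) (UnitaryGroup.finSum 1 n₂ T₁ T₂) v)).comp s)).comp (UnitaryGroup.localCenter E c (1 + n₂) J J' hJ' v)) χ ((MpPsi.toRep (localSchrodinger F (1 + n₂) (UnitaryGroup.finSum 1 n₂ T₁ T₂) v)).comp s) (fun g z => (show Commute g ((UnitaryGroup.localCenter E c (1 + n₂) J J' hJ' v) z) from
        UnitaryGroup.localCenter_comm E c (1 + n₂) J J' hJ' v z g).map ((MpPsi.toRep (localSchrodinger F (1 + n₂) (UnitaryGroup.finSum 1 n₂ T₁ T₂) v)).comp s))).comp (inlLoc F E c v 1 n₂ hJ₁ hJ)) := by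
  -- `ω_s ∘ (· ⊕ 1)` is smooth (stabilisers are preimages under the continuous `inlLoc`)
  have h1 : Representation.IsSmooth ((((MpPsi.toRep (localSchrodinger F (1 + n₂) (UnitaryGroup.finSum 1 n₂ T₁ T₂) v)).comp s)).comp (inlLoc F E c v 1 n₂ hJ₁ hJ)) := fun f =>
    (hsm f).preimage (continuous_inlLoc F E c v 1 n₂ hJ₁ hJ)
  -- the coinvariant representation of the restricted action is a quotient of it by the surjective intertwiner `mk`
  have h2 : Representation.IsSmooth (rep (ρW := (((MpPsi.toRep (localSchrodinger F (1 + n₂) (UnitaryGroup.finSum 1 n₂ T₁ T₂) v)).comp s)).comp (UnitaryGroup.localCenter E c (1 + n₂) J J' hJ' v)) χ ((((MpPsi.toRep (localSchrodinger F (1 + n₂) (UnitaryGroup.finSum 1 n₂ T₁ T₂) v)).comp s)).comp (inlLoc F E c v 1 n₂ hJ₁ hJ))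
      (commute_inlLoc_localCenter F E c v 1 n₂ hJ₁ hJ s hJ')) :=
    h1.of_surjective (((mk ((((MpPsi.toRep (localSchrodinger F (1 + n₂) (UnitaryGroup.finSum 1 n₂ T₁ T₂) v)).comp s)).comp (UnitaryGroup.localCenter E c (1 + n₂) J J' hJ' v)) χ).intertwiningMap_of_isIntertwiningMap _ _ fun g f =>
      (rep_mk χ _ _ g f).symm)) (mk_surjective _ χ)
  -- … and restricting `Θ_s(χ)` to the first block IS that representation (★ `rep_comp_inlLoc_eq`)
  rw [rep_comp_inlLoc_eq F E c v 1 n₂ hJ₁ hJ s hJ' χ]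
  exact h2

-- block-currency terms + the compact-group occurrence lemma: about 2× the default budget
set_option maxHeartbeats 400000 in
/-- **THE TWO-BLOCK TYPE CRITERION** (non-split place, first block a line): for every character `χ` of the centre,
`Θ_s(χ) = Coinv_χ(ω_s ∘ cZ) ≠ 0` (`cZ`, `c₁`, `c₂` the centre embeddings into `U(J)`, `U(J₁)`, `U(J₂)`) **iff** there is a character `ξ` of the compact torus `U(J₁)(F_v)` with OPEN kernel, unitary and continuous,
such that BOTH `Coinv_ξ(ω_{s₁}) ≠ 0` and `Coinv_{χ·(ξ∘c₁)⁻¹}(ω_{s₂} ∘ c₂) ≠ 0`.  (⇒) a non-zero smooth representation of a compact commutative group has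
a type (★ `exists_character_nontrivial_coinv_of_isSmooth`), split by ★ `coinvLineEquiv`; (⇐) ★ `coinvLineEquiv` backwards.
[cite: MoeglinVignerasWaldspurger1987, Chap. 2 II.1 Rem. (6)] [cite: Kudla1984, §1] -/
theorem nontrivial_theta_iff_exists_lineType (hE : IsField (UnitaryGroup.LocalRing E v))
    (hsm : Representation.IsSmooth ((MpPsi.toRep (localSchrodinger F (1 + n₂) (UnitaryGroup.finSum 1 n₂ T₁ T₂) v)).comp s))
    (χ : (UnitaryGroup.localPi E c 1 J' v) →* ℂˣ) :
    Nontrivial (Coinv ((((MpPsi.toRep (localSchrodinger F (1 + n₂) (UnitaryGroup.finSum 1 n₂ T₁ T₂) v)).comp s)).comp (UnitaryGroup.localCenter E c (1 + n₂) J J' hJ' v)) χ) ↔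
      ∃ ξ : (UnitaryGroup.localPi E c 1 J₁ v) →* ℂˣ, IsOpen (ξ.ker : Set (UnitaryGroup.localPi E c 1 J₁ v)) ∧ (∀ u, ‖((ξ u : ℂˣ) : ℂ)‖ = 1) ∧ (Continuous fun u => ((ξ u : ℂˣ) : ℂ)) ∧
        Nontrivial (Coinv ((MpPsi.toRep (localSchrodinger F 1 T₁ v)).comp (restrictLeft F E c v 1 n₂ hJ₁ hJ hcδ hδ hd hT₁ hT₂ hT₂d s hs)) ξ) ∧ Nontrivial (Coinv ((((MpPsi.toRep (localSchrodinger F n₂ T₂ v)).comp (restrictRight F E c v 1 n₂ hJ₂ hJ hcδ hδ hd hT₁ hT₂ hT₁d s hs))).comp (UnitaryGroup.localCenter E c n₂ J₂ J' hJ' v)) (χ * (ξ.comp (UnitaryGroup.localCenter E c 1 J₁ J' hJ' v))⁻¹)) := by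
  haveI : CompactSpace (UnitaryGroup.localPi E c 1 J₁ v) := compactSpace_localPi_rankOne F E c hcδ hδ hT₁d hJ₁ v hE
  constructor
  · intro hΘ
    haveI := hΘ
    obtain ⟨ξ, hξo, hξu, hξc, hnt⟩ := exists_character_nontrivial_coinv_of_isSmooth
      ((rep (ρW := (((MpPsi.toRep (localSchrodinger F (1 + n₂) (UnitaryGroup.finSum 1 n₂ T₁ T₂) v)).comp s)).comp (UnitaryGroup.localCenter E c (1 + n₂) J J' hJ' v)) χ ((MpPsi.toRep (localSchrodinger F (1 + n₂) (UnitaryGroup.finSum 1 n₂ T₁ T₂) v)).comp s) (fun g z => (show Commute g ((UnitaryGroup.localCenter E c (1 + n₂) J J' hJ' v) z) from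
        UnitaryGroup.localCenter_comm E c (1 + n₂) J J' hJ' v z g).map ((MpPsi.toRep (localSchrodinger F (1 + n₂) (UnitaryGroup.finSum 1 n₂ T₁ T₂) v)).comp s))).comp (inlLoc F E c v 1 n₂ hJ₁ hJ))
      (UnitaryGroup.localPi_one_mul_comm E c J₁ v) (isSmooth_rep_comp_inlLoc F E c v n₂ hJ₁ hJ s hJ' hsm χ)
    haveI := hnt
    have e := (coinvLineEquiv F E c hcδ hδ hd v 1 n₂ hT₁ hT₂ hT₁d hT₂d hJ₁ hJ₂ hJ s hs hJ' ξ χ).toEquiv.nontrivial_congr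
    exact ⟨ξ, hξo, hξu, hξc, nontrivial_tensor_iff.1 (e.1 hnt)⟩
  · rintro ⟨ξ, -, -, -, h₁, h₂⟩
    haveI := h₁
    haveI := h₂
    have e := (coinvLineEquiv F E c hcδ hδ hd v 1 n₂ hT₁ hT₂ hT₁d hT₂d hJ₁ hJ₂ hJ s hs hJ' ξ χ).toEquiv.nontrivial_congr
    haveI := e.2 (nontrivial_tensor_iff.2 ⟨h₁, h₂⟩)
    exact nontrivial_of_nontrivial_coinv
      ((rep (ρW := (((MpPsi.toRep (localSchrodinger F (1 + n₂) (UnitaryGroup.finSum 1 n₂ T₁ T₂) v)).comp s)).comp (UnitaryGroup.localCenter E c (1 + n₂) J J' hJ' v)) χ ((MpPsi.toRep (localSchrodinger F (1 + n₂) (UnitaryGroup.finSum 1 n₂ T₁ T₂) v)).comp s) (fun g z => (show Commute g ((UnitaryGroup.localCenter E c (1 + n₂) J J' hJ' v) z) from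
        UnitaryGroup.localCenter_comm E c (1 + n₂) J J' hJ' v z g).map ((MpPsi.toRep (localSchrodinger F (1 + n₂) (UnitaryGroup.finSum 1 n₂ T₁ T₂) v)).comp s))).comp (inlLoc F E c v 1 n₂ hJ₁ hJ)) ξ

set_option maxHeartbeats 400000 in -- block-currency terms
/-- **(⇐) alone, for any character `ξ` of the first block**: if `Coinv_ξ(ω_{s₁}) ≠ 0` and `Coinv_{χ·(ξ∘c₁)⁻¹}(ω_{s₂} ∘ c₂) ≠ 0` then `Θ_s(χ) ≠ 0`
(no compactness, no topology on `ξ`: ★ `coinvLineEquiv` backwards). [cite: MoeglinVignerasWaldspurger1987, Chap. 2 II.1 Rem. (6)] [cite: Kudla1984, §1] -/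
theorem nontrivial_theta_of_lineTypes (χ : (UnitaryGroup.localPi E c 1 J' v) →* ℂˣ) (ξ : (UnitaryGroup.localPi E c 1 J₁ v) →* ℂˣ)
    [h₁ : Nontrivial (Coinv ((MpPsi.toRep (localSchrodinger F 1 T₁ v)).comp (restrictLeft F E c v 1 n₂ hJ₁ hJ hcδ hδ hd hT₁ hT₂ hT₂d s hs)) ξ)] [h₂ : Nontrivial (Coinv ((((MpPsi.toRep (localSchrodinger F n₂ T₂ v)).comp (restrictRight F E c v 1 n₂ hJ₂ hJ hcδ hδ hd hT₁ hT₂ hT₁d s hs))).comp (UnitaryGroup.localCenter E c n₂ J₂ J' hJ' v)) (χ * (ξ.comp (UnitaryGroup.localCenter E c 1 J₁ J' hJ' v))⁻¹))] :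
    Nontrivial (Coinv ((((MpPsi.toRep (localSchrodinger F (1 + n₂) (UnitaryGroup.finSum 1 n₂ T₁ T₂) v)).comp s)).comp (UnitaryGroup.localCenter E c (1 + n₂) J J' hJ' v)) χ) := by
  have e := (coinvLineEquiv F E c hcδ hδ hd v 1 n₂ hT₁ hT₂ hT₁d hT₂d hJ₁ hJ₂ hJ s hs hJ' ξ χ).toEquiv.nontrivial_congr
  haveI := e.2 (nontrivial_tensor_iff.2 ⟨h₁, h₂⟩)
  exact nontrivial_of_nontrivial_coinv
    ((rep (ρW := (((MpPsi.toRep (localSchrodinger F (1 + n₂) (UnitaryGroup.finSum 1 n₂ T₁ T₂) v)).comp s)).comp (UnitaryGroup.localCenter E c (1 + n₂) J J' hJ' v)) χ ((MpPsi.toRep (localSchrodinger F (1 + n₂) (UnitaryGroup.finSum 1 n₂ T₁ T₂) v)).comp s) (fun g z => (show Commute g ((UnitaryGroup.localCenter E c (1 + n₂) J J' hJ' v) z) from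
      UnitaryGroup.localCenter_comm E c (1 + n₂) J J' hJ' v z g).map ((MpPsi.toRep (localSchrodinger F (1 + n₂) (UnitaryGroup.finSum 1 n₂ T₁ T₂) v)).comp s))).comp (inlLoc F E c v 1 n₂ hJ₁ hJ)) ξ

end Literature.RepresentationTheory.MoeglinVignerasWaldspurger1987

end
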